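import Summits.Ventures.HodgeRepro2.T5FinitePlaceIsotropy
import Summits.Ventures.HodgeRepro2.T5FinitePlaceIsometryCriterion
import Summits.Ventures.HodgeRepro2.T5LandherrGeneralTools

/-!
# Hermitian forms in `≥ 3` variables are isotropic at every finite non-split place
(cell pub-hodge-repro2, seat p3)

Tier-5 N2 support, rows N2.2.2 / N2.8.1 of route/T5-N2-route-3.md, and the N3 lane's «isotropy of `V_v`»
(seat p8's T5-141 `exists_congruent_J3_integral_of_isotropic_of_unramified` takes an isotropic vector of the
Gram matrix as a hypothesis, recorded as «printed» in LEAN-ANNEX-p8.md §108 / §110). Under the binary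
universality `(U)` (file 136's `BinaryUniversal`), every invertible hermitian matrix of size `≥ 3` has an
isotropic vector: diagonalise (file 129), represent `−d_k` by `⟨d_i, d_j⟩` (`(U)`), and transport the vector
`x e_i + y e_j + e_k` along the congruence. Since `(U)` holds on `K_w` at EVERY finite non-split place of `K⁺`
(file 150, dyadic places included), the classical fact «a hermitian form in at least three variables over a
`p`-adic field is isotropic» (Jacobowitz 1962 §6 / O'Meara 63:19's hermitian counterpart) is in the kernel
with no display:
* `formVal_diagonal_three` — the value of a diagonal form on `x e_i + y e_j + z e_k`;
* **`exists_formVal_eq_zero`** — under `(U)`, an invertible hermitian matrix on an index type of cardinality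
  `≥ 3` has a non-zero isotropic vector;
* **`exists_formVal_eq_zero_of_nonsplit`** — on the route's `E_w` at every finite non-split place, with file 119's
  star; **`exists_formVal_eq_zero_local`** — the CM-field form (`K_w / K⁺_v`, file 146's `localStarRing`).

Mathlib + this seat's files 129 / 136 / 139 / 150 / 172 and their imports; no display; no device.
§8(d): uses an L-value-free non-vanishing device: NO.
-/

namespace Summit.Ventures.HodgeRepro2.T5HermitianLocalIsotropy

open Matrix IsDedekindDomain IsDedekindDomain.HeightOneSpectrum NumberField NumberField.IsCMField
open Summit.Ventures.HodgeRepro2.T5HermitianDetClass Summit.Ventures.HodgeRepro2.T5HermitianDiagonalize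
  Summit.Ventures.HodgeRepro2.T5HermitianClassify Summit.Ventures.HodgeRepro2.T5LandherrGeneralTools
  Summit.Ventures.HodgeRepro2.T5FinitePlaceStar Summit.Ventures.HodgeRepro2.T5FinitePlaceIsotropy
  Summit.Ventures.HodgeRepro2.T5FinitePlaceIsometryCriterion

/-! ## Under `(U)`: isotropy in three or more variables -/

section Abstract

variable {E : Type*} [Field E] [StarRing E]

/-- The value of the diagonal form `diag d` on the vector with `x, y, z` at three distinct indices `i, j, k`
and `0` elsewhere: `N(x) dᵢ + N(y) dⱼ + N(z) d_k`. -/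
theorem formVal_diagonal_three {ι : Type*} [Fintype ι] [DecidableEq ι] (d : ι → E) {i j k : ι}
    (hij : i ≠ j) (hik : i ≠ k) (hjk : j ≠ k) (x y z : E) :
    formVal (diagonal d) (fun l => if l = i then x else if l = j then y else if l = k then z else 0) =
      star x * x * d i + star y * y * d j + star z * z * d k := by
  rw [formVal_diagonal]
  rw [← Finset.add_sum_erase _ _ (Finset.mem_univ k)]
  rw [Finset.sum_eq_add i j hij (fun l hl hl' => by
        have hlk : l ≠ k := (Finset.mem_erase.mp hl).1
        simp [hl'.1, hl'.2, hlk])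
      (fun h => absurd (Finset.mem_erase.mpr ⟨hik, Finset.mem_univ i⟩) h)
      (fun h => absurd (Finset.mem_erase.mpr ⟨hjk, Finset.mem_univ j⟩) h)]
  simp only [if_true, hik, hjk, hij, if_false, hik.symm, hjk.symm, hij.symm]
  ring

/-- **Under `(U)`, an invertible hermitian form in `≥ 3` variables is isotropic:** diagonalise `H ≅ diag d`
(`Pᴴ H P = diag d`, all `dᵢ ≠ 0` star-fixed), represent `−d_k` by `⟨dᵢ, dⱼ⟩` through `(U)`, and transport
`x eᵢ + y eⱼ + e_k` along `P`. -/
theorem exists_formVal_eq_zero (hμ : ∃ μ : E, μ + star μ ≠ 0) (hU : BinaryUniversal E) {ι : Type*} [Fintype ι]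
    [DecidableEq ι] (h3 : 2 < Fintype.card ι) {H : Matrix ι ι E} (hH : H.IsHermitian) (hdet : IsUnit H.det) :
    ∃ w : ι → E, w ≠ 0 ∧ formVal H w = 0 := by
  obtain ⟨d, hd, hd0, ⟨P, hP, hPH⟩⟩ := exists_congruent_diagonal_ne_zero hμ H hH hdet
  obtain ⟨i, j, k, hij, hik, hjk⟩ := Fintype.two_lt_card_iff.mp h3
  have hdk : star (-d k) = -d k := by rw [star_neg, hd k]
  obtain ⟨x, y, hxy⟩ := hU (d i) (d j) (-d k) (hd i) (hd j) hdk (hd0 i) (hd0 j) (neg_ne_zero.mpr (hd0 k))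
  set w' : ι → E := fun l => if l = i then x else if l = j then y else if l = k then 1 else 0 with hw'
  have hval : formVal H (P *ᵥ w') = 0 := by
    rw [← formVal_conjTranspose_mul_mul, hPH, hw', formVal_diagonal_three d hij hik hjk, hxy, star_one, one_mul,
      one_mul, neg_add_cancel]
  refine ⟨P *ᵥ w', ?_, hval⟩
  intro h0
  have hinj : Function.Injective (P.mulVec) :=
    mulVec_injective_iff_isUnit.mpr ((isUnit_iff_isUnit_det P).mpr hP)
  have hw'0 : w' = 0 := hinj (by rw [h0, mulVec_zero])
  have := congrFun hw'0 k
  simp [hw', hik.symm, hjk.symm] at this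

end Abstract

/-! ## At every finite non-split place -/

section Local

variable {F E : Type*} [Field F] [NumberField F] [Field E] [NumberField E] [Algebra F E]
  [Algebra.IsQuadraticExtension F E]
variable (v : HeightOneSpectrum (𝓞 F)) (w : HeightOneSpectrum (𝓞 E)) [w.asIdeal.LiesOver v.asIdeal]
variable {s : E} {θ : F}
variable (hs : s ^ 2 = algebraMap F E θ) (hspan : Submodule.span F {(1 : E), s} = ⊤)
  (hsq : ¬ IsSquare (algebraMap F (v.adicCompletion F) θ)) (c : E ≃ₐ[F] E) (hc : c s = -s)

include hs hspan hsq hc in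
/-- **Every invertible hermitian matrix of size `≥ 3` over `E_w` is isotropic, at every finite non-split place
of `F`** (file 119's star; `(U)` from file 150, `μ + star μ ≠ 0` from file 139). -/
theorem exists_formVal_eq_zero_of_nonsplit {ι : Type*} [Fintype ι] [DecidableEq ι] (h3 : 2 < Fintype.card ι)
    {H : Matrix ι ι (w.adicCompletion E)}
    (hH : letI := localStarRing v w hs hspan hsq c hc; H.IsHermitian) (hdet : IsUnit H.det) :
    letI := localStarRing v w hs hspan hsq c hc
    ∃ x : ι → w.adicCompletion E, x ≠ 0 ∧ formVal H x = 0 := by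
  letI := localStarRing v w hs hspan hsq c hc
  exact exists_formVal_eq_zero (exists_add_star_ne_zero_local v w hs hspan hsq c hc)
    (binaryUniversal_of_nonsplit v w hs hspan hsq c hc) h3 hH hdet

end Local

/-! ## The CM-field form -/

section CM

variable (K : Type*) [Field K] [NumberField K] [IsCMField K]
variable {θ : maximalRealSubfield K} {y : K}
variable (hθ : algebraMap (maximalRealSubfield K) K θ = y ^ 2) (hy : complexConj K y ≠ y)
variable (v : HeightOneSpectrum (𝓞 (maximalRealSubfield K))) (w : HeightOneSpectrum (𝓞 K))
  [w.asIdeal.LiesOver v.asIdeal]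
variable (hsq : ¬ IsSquare (algebraMap (maximalRealSubfield K) (v.adicCompletion (maximalRealSubfield K)) θ))

include hθ hy hsq in
/-- **The CM-field form:** at every finite place `v` of `K⁺` non-split in `K` and every `w ∣ v`, every invertible
hermitian matrix of size `≥ 3` over `K_w` (file 146's `localStarRing` — the local complex conjugation as `star`)
has a non-zero isotropic vector. The hypothesis «isotropy of `V_v`» of the N3 lane (LEAN-ANNEX-p8.md §108) in
the vocabulary of this lane. -/
theorem exists_formVal_eq_zero_local {ι : Type*} [Fintype ι] [DecidableEq ι] (h3 : 2 < Fintype.card ι)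
    {H : Matrix ι ι (w.adicCompletion K)}
    (hH : letI := T5FinitePlaceCM.localStarRing K hθ hy v w hsq; H.IsHermitian) (hdet : IsUnit H.det) :
    letI := T5FinitePlaceCM.localStarRing K hθ hy v w hsq
    ∃ x : ι → w.adicCompletion K, x ≠ 0 ∧ formVal H x = 0 :=
  exists_formVal_eq_zero_of_nonsplit v w hθ.symm (T5FinitePlaceCM.span_pair_eq_top K hy) hsq (complexConj K)
    (T5FinitePlaceCM.complexConj_apply_eq_neg K hθ hy) h3 hH hdet

end CM

end Summit.Ventures.HodgeRepro2.T5HermitianLocalIsotropy
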